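import Literature.NumberTheory.EllipticCurves.LeadingTermBSZResCellAssemblyProofs
import HarnessLib

/-!
# The rank-part constant `c_rank = 3059480216411717/4576171406400000` survives the instantiation
# allowances: the FULL instantiation (`κ' = .5501 − 10⁻⁶`) and the TRUNCATED one (`μT, μR` less `10⁻⁷`)

Sibling (leaf) of `LeadingTermBSZResCellAssemblyProofs` (bsd.S27: Bhargava–Skinner–Zhang Cor 26
assembled with the local-equidistribution piece; `bsz_rankLeOne_cRank_of_pieces`). Theorems only: no
definition, no named fact (D-0014 / D-0026, debt `+0`). HONEST FRAMING: bookkeeping in `ℝ`; nothing is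
booked, no density number of record, RESIDUAL-MAP mark, tier or K1 word moves by this file.

Why (cell book `cells/density/C0-SPEC.md`, G11 "instantiation shape"): the numeric capstone
`bsz_rankLeOne_cRank_of_pieces` fixes `κ = .5501` in the root-number-subfamily binders `hκU` / `hκU₀`
and the exact densities `μT = μ(S₁′(5)) = 747265625/953369043`, `μR = μ(T₅) = 78125/3813476172` in
`hT` / `hR`. Bhargava–Skinner–Zhang's Thm 16 (the tree's A328 / A331,
`BhargavaSkinnerZhang2014/RootNumberTwistSubfamily.lean`) and Bhargava–Shankar's Thm 31 (A330) are
stated for LARGE CONGRUENCE FAMILIES, whereas the pieces `T = S₁′(5)` and `R = T₅` of the instantiation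
(`BhargavaSkinnerZhang2014/Pieces.lean`) are not congruence families (the condition `5 ∤ ord₅ Δ′`
involves all levels `k`). The cell's link files therefore produce the binders in one of two shapes:

* FULL: `T := S₁′`, `R := T₅` with `hT` / `hR` EXACT, and the subfamilies `U ⊆ T₉ ⊆ T`,
  `U₀ ⊆ R₁₆ ⊆ R` obtained from Thm 16 on the level-truncated congruence families, so that
  `hκU` / `hκU₀` hold with `κ' = .5501 − 10⁻⁶` (the tails `T ∖ T₉`, `R ∖ R₁₆` have density
  `≤ 10⁻⁷ ≪ 10⁻⁶·μ`);
* TRUNC: `T := T_K = S₁′ ∩ {ord₅ Δ′ ≤ K}`, `R := R_K` (`K ≥ 9`) — congruence families, `κ = .5501`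
  exactly — with `hT` / `hR` weakened by the tail allowance `10⁻⁷`.

This file records that `c_rank` survives either allowance, by the parametric assembly
`heightDensityGE_satisfiesBSDRankLeOne_of_resPieces` and `norm_num`:
`(19/24 + κ'/12)·μT + 3/8·κ'·μR + 3/4·(μ(SP′) − 10⁻⁶) − 10⁻⁵ − c_rank = 8.5·10⁻⁷ > 0` (FULL; the
`κ`-derivative `μT/12 + 3/8·μR = .0653` costs `6.5·10⁻⁸`) and
`(19/24 + κ/12)·(μT − 10⁻⁷) + 3/8·κ·(μR − 10⁻⁷) + 3/4·(μ(SP′) − 10⁻⁶) − 10⁻⁵ − c_rank = 8.1·10⁻⁷ > 0`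
(TRUNC), against the margin `9.1(6)·10⁻⁷` of `bsz_rankLeOne_cRank_of_pieces` (`bsz_cRank_eq`).

## Contents

* `bsz_cRank_le_full`, `bsz_cRank_le_trunc` — the two inequalities.
* `bsz_rankLeOne_cRank_of_pieces_full` — `bsz_rankLeOne_cRank_of_pieces` with `hκU` / `hκU₀` at
  `0.5501 - 1/1000000` (all other binders byte-identical).
* `bsz_rankLeOne_cRank_of_pieces_trunc` — `bsz_rankLeOne_cRank_of_pieces` with `hT` at
  `747265625/953369043 - 1/10000000` and `hR` at `78125/3813476172 - 1/10000000` (all other binders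
  byte-identical).

## References

* [BhargavaSkinnerZhang2014] M. Bhargava, C. Skinner, W. Zhang, arXiv:1407.1826v2 (2014): Cor 26
  (proof, pp. 10–13), Thm 16, Lemmas 17–18, display (2).
* [BhargavaSkinner2014] M. Bhargava, C. Skinner, J. Ramanujan Math. Soc. 29 (2014): Thm 7 (ii),
  Lemma 16.
* [BhargavaShankar5Selmer2013] M. Bhargava, A. Shankar, arXiv:1312.7859 (2013): Thm 31, §5.
-/

set_option autoImplicit false

noncomputable section

open scoped Classical
open scoped AddSubgroup
open Filter Topology WeierstrassCurve

namespace Literature.NumberTheory.EllipticCurves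

/-! ### The two margins -/

/-- **FULL-instantiation margin**: with `κ' = .5501 − 10⁻⁶` in place of `κ = .5501`,
`c_rank ≤ (19/24 + κ'/12)·μ(S₁′(5)) + 3/8·κ'·μ(T₅) + 3/4·(μ(SP′) − 10⁻⁶) − 10⁻⁵`
(margin `≈ 8.5·10⁻⁷`). [cite: BhargavaSkinnerZhang2014, Cor 26 (final display) with Lemma 18 corrected and Thm 16] -/
theorem bsz_cRank_le_full :
    (3059480216411717 : ℝ) / 4576171406400000 ≤
      (19 / 24 + (0.5501 - 1 / 1000000) / 12) * (747265625 / 953369043) +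
          3 / 8 * (0.5501 - 1 / 1000000) * (78125 / 3813476172) +
        3 / 4 * (20546875 / 1271158724 - 1 / 1000000) - 0.00001 := by
  norm_num

/-- **TRUNC-instantiation margin**: with the tail allowance `10⁻⁷` taken off `μ(S₁′(5))` and `μ(T₅)`
(pieces truncated at `ord₅ Δ′ ≤ K`, `K ≥ 9`) and `κ = .5501` exactly,
`c_rank ≤ (19/24 + κ/12)·(μ(S₁′(5)) − 10⁻⁷) + 3/8·κ·(μ(T₅) − 10⁻⁷) + 3/4·(μ(SP′) − 10⁻⁶) − 10⁻⁵`
(margin `≈ 8.1·10⁻⁷`). [cite: BhargavaSkinnerZhang2014, Cor 26 (final display) with Lemma 18 corrected] -/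
theorem bsz_cRank_le_trunc :
    (3059480216411717 : ℝ) / 4576171406400000 ≤
      (19 / 24 + 0.5501 / 12) * (747265625 / 953369043 - 1 / 10000000) +
          3 / 8 * 0.5501 * (78125 / 3813476172 - 1 / 10000000) +
        3 / 4 * (20546875 / 1271158724 - 1 / 1000000) - 0.00001 := by
  norm_num

/-! ### The numeric capstone under the two allowances -/

/-- **The rank part at `c_rank`, FULL instantiation** (`T := S₁′(5)`, `R := T₅` with exact densities;
root-number subfamilies of relative density `κ' = .5501 − 10⁻⁶`): the statement of
`bsz_rankLeOne_cRank_of_pieces` with `hκU` / `hκU₀` weakened to `0.5501 - 1/1000000` and every other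
binder unchanged; proof = the parametric assembly `heightDensityGE_satisfiesBSDRankLeOne_of_resPieces`
at `κ = 0.5501 - 1/1000000` and `bsz_cRank_le_full`'s arithmetic.
[cite: BhargavaSkinnerZhang2014, Cor 26 (proof) with Lemma 18 corrected, Thm 16, display (2)]
[cite: BhargavaSkinner2014, Thm 7 (ii) and Lemma 16] -/
theorem bsz_rankLeOne_cRank_of_pieces_full
    (hGZK : rank_eq_analyticRank_of_analyticRank_le_one)
    (hDD : even_selmerRank_sub_torsionRank_iff) (S₀ T U R U₀ P S₁ W : ℤ × ℤ → Prop)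
    (Z : (AB : ℤ × ℤ) → AddSubgroup ((shortWeierstrass AB).selmerGroup 5))
    (hTS₀ : ∀ AB, T AB → S₀ AB) (hUT : ∀ AB, U AB → T AB)
    (hRS₀ : ∀ AB, R AB → S₀ AB) (hRT : ∀ AB, R AB → ¬ T AB) (hU₀R : ∀ AB, U₀ AB → R AB)
    (hPS₀ : ∀ AB, P AB → S₀ AB) (hPT : ∀ AB, P AB → ¬ T AB) (hPR : ∀ AB, P AB → ¬ R AB)
    (hU : ∀ AB, U AB → U (negB AB))
    (hUflip : ∀ AB, U AB →
      (shortWeierstrass (negB AB)).rootNumber = -(shortWeierstrass AB).rootNumber)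
    (hU₀ : ∀ AB, U₀ AB → U₀ (negB AB))
    (hU₀flip : ∀ AB, U₀ AB →
      (shortWeierstrass (negB AB)).rootNumber = -(shortWeierstrass AB).rootNumber)
    (h5 : ∀ AB, IsInHeightFamily AB → S₀ AB → W AB →
      Nat.card ((shortWeierstrass AB).selmerGroup 5) = 1 →
        (shortWeierstrass AB).mordellWeilRank = 0 ∧ (shortWeierstrass AB).analyticRank = 0)
    (h9 : ∀ AB, IsInHeightFamily AB → T AB → S₁ AB → W AB →
      Nat.card ((shortWeierstrass AB).selmerGroup 5) = 5 →
        (shortWeierstrass AB).mordellWeilRank = 1 ∧ (shortWeierstrass AB).analyticRank = 1)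
    (hker : ∀ AB, IsInHeightFamily AB → P AB →
      Nat.card ((shortWeierstrass AB).selmerGroup 5) ≤ 5 * Nat.card (Z AB))
    (hKim : ∀ AB, IsInHeightFamily AB → P AB → W AB →
      Nat.card ((shortWeierstrass AB).selmerGroup 5) = 5 → Nat.card (Z AB) = 1 →
        (shortWeierstrass AB).mordellWeilRank = 1 ∧ (shortWeierstrass AB).analyticRank = 1)
    (hWtors : ∀ AB, IsInHeightFamily AB → W AB → (shortWeierstrass AB).toAffine.Point[(5 : ℤ)] = ⊥)
    (h13T : ∀ η : ℝ, 0 < η → ∀ᶠ X : ℕ in atTop,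
      ∑ AB ∈ (heightFamilyBelow X).filter T,
          (Nat.card ((shortWeierstrass AB).selmerGroup 5) : ℝ) ≤
        (6 + η) * ((heightFamilyBelow X).filter T).card)
    (h13U₀ : ∀ η : ℝ, 0 < η → ∀ᶠ X : ℕ in atTop,
      ∑ AB ∈ (heightFamilyBelow X).filter U₀,
          (Nat.card ((shortWeierstrass AB).selmerGroup 5) : ℝ) ≤
        (6 + η) * ((heightFamilyBelow X).filter U₀).card)
    (hlocP : ∀ η : ℝ, 0 < η → ∀ᶠ X : ℕ in atTop,
      ∑ AB ∈ (heightFamilyBelow X).filter P, ((Nat.card (Z AB) : ℝ) - 1) ≤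
        (1 + η) * ((heightFamilyBelow X).filter P).card)
    (hT : ∀ η : ℝ, 0 < η → ∀ᶠ X : ℕ in atTop,
      (747265625 / 953369043 - η) * (heightFamilyBelow X).card ≤
        ((heightFamilyBelow X).filter T).card)
    (hκU : ∀ η : ℝ, 0 < η → ∀ᶠ X : ℕ in atTop,
      (0.5501 - 1 / 1000000 - η) * ((heightFamilyBelow X).filter T).card ≤
        ((heightFamilyBelow X).filter U).card)
    (hR : ∀ η : ℝ, 0 < η → ∀ᶠ X : ℕ in atTop,
      (78125 / 3813476172 - η) * (heightFamilyBelow X).card ≤ ((heightFamilyBelow X).filter R).card)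
    (hκU₀ : ∀ η : ℝ, 0 < η → ∀ᶠ X : ℕ in atTop,
      (0.5501 - 1 / 1000000 - η) * ((heightFamilyBelow X).filter R).card ≤
        ((heightFamilyBelow X).filter U₀).card)
    (hPd : ∀ η : ℝ, 0 < η → ∀ᶠ X : ℕ in atTop,
      (20546875 / 1271158724 - 1 / 1000000 - η) * (heightFamilyBelow X).card ≤
        ((heightFamilyBelow X).filter P).card)
    (hν : ∀ η : ℝ, 0 < η → ∀ᶠ X : ℕ in atTop,
      (((heightFamilyBelow X).filter (fun AB ↦ T AB ∧ ¬ S₁ AB)).card : ℝ) ≤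
        (0.00001 + η) * (heightFamilyBelow X).card)
    (hW : ∀ η : ℝ, 0 < η → ∀ᶠ X : ℕ in atTop,
      (((heightFamilyBelow X).filter (fun AB ↦ ¬ W AB)).card : ℝ) ≤ η * (heightFamilyBelow X).card) :
    HeightDensityGE SatisfiesBSDRankLeOne (3059480216411717 / 4576171406400000) :=
  heightDensityGE_satisfiesBSDRankLeOne_of_resPieces hGZK hDD S₀ T U R U₀ P S₁ W Z hTS₀ hUT hRS₀ hRT
    hU₀R hPS₀ hPT hPR hU hUflip hU₀ hU₀flip h5 h9 hker hKim hWtors h13T h13U₀ hlocP (by norm_num)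
    (by norm_num) (by norm_num) (by norm_num) (by norm_num) hT hκU hR hκU₀ hPd hν hW (by norm_num)

/-- **The rank part at `c_rank`, TRUNC instantiation** (`T := S₁′(5) ∩ {ord₅ Δ′ ≤ K}`, `R := T₅ ∩
{ord₅ Δ′ ≤ K}`, `K ≥ 9`, congruence families; `κ = .5501` exactly): the statement of
`bsz_rankLeOne_cRank_of_pieces` with `hT` weakened to `747265625/953369043 - 1/10000000` and `hR` to
`78125/3813476172 - 1/10000000`, every other binder unchanged; proof = the parametric assembly at
`μT = 747265625/953369043 - 10⁻⁷`, `μR = 78125/3813476172 - 10⁻⁷` and `bsz_cRank_le_trunc`'s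
arithmetic. [cite: BhargavaSkinnerZhang2014, Cor 26 (proof) with Lemma 18 corrected, Thm 16, display (2)]
[cite: BhargavaSkinner2014, Thm 7 (ii) and Lemma 16] -/
theorem bsz_rankLeOne_cRank_of_pieces_trunc
    (hGZK : rank_eq_analyticRank_of_analyticRank_le_one)
    (hDD : even_selmerRank_sub_torsionRank_iff) (S₀ T U R U₀ P S₁ W : ℤ × ℤ → Prop)
    (Z : (AB : ℤ × ℤ) → AddSubgroup ((shortWeierstrass AB).selmerGroup 5))
    (hTS₀ : ∀ AB, T AB → S₀ AB) (hUT : ∀ AB, U AB → T AB)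
    (hRS₀ : ∀ AB, R AB → S₀ AB) (hRT : ∀ AB, R AB → ¬ T AB) (hU₀R : ∀ AB, U₀ AB → R AB)
    (hPS₀ : ∀ AB, P AB → S₀ AB) (hPT : ∀ AB, P AB → ¬ T AB) (hPR : ∀ AB, P AB → ¬ R AB)
    (hU : ∀ AB, U AB → U (negB AB))
    (hUflip : ∀ AB, U AB →
      (shortWeierstrass (negB AB)).rootNumber = -(shortWeierstrass AB).rootNumber)
    (hU₀ : ∀ AB, U₀ AB → U₀ (negB AB))
    (hU₀flip : ∀ AB, U₀ AB →
      (shortWeierstrass (negB AB)).rootNumber = -(shortWeierstrass AB).rootNumber)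
    (h5 : ∀ AB, IsInHeightFamily AB → S₀ AB → W AB →
      Nat.card ((shortWeierstrass AB).selmerGroup 5) = 1 →
        (shortWeierstrass AB).mordellWeilRank = 0 ∧ (shortWeierstrass AB).analyticRank = 0)
    (h9 : ∀ AB, IsInHeightFamily AB → T AB → S₁ AB → W AB →
      Nat.card ((shortWeierstrass AB).selmerGroup 5) = 5 →
        (shortWeierstrass AB).mordellWeilRank = 1 ∧ (shortWeierstrass AB).analyticRank = 1)
    (hker : ∀ AB, IsInHeightFamily AB → P AB →
      Nat.card ((shortWeierstrass AB).selmerGroup 5) ≤ 5 * Nat.card (Z AB))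
    (hKim : ∀ AB, IsInHeightFamily AB → P AB → W AB →
      Nat.card ((shortWeierstrass AB).selmerGroup 5) = 5 → Nat.card (Z AB) = 1 →
        (shortWeierstrass AB).mordellWeilRank = 1 ∧ (shortWeierstrass AB).analyticRank = 1)
    (hWtors : ∀ AB, IsInHeightFamily AB → W AB → (shortWeierstrass AB).toAffine.Point[(5 : ℤ)] = ⊥)
    (h13T : ∀ η : ℝ, 0 < η → ∀ᶠ X : ℕ in atTop,
      ∑ AB ∈ (heightFamilyBelow X).filter T,
          (Nat.card ((shortWeierstrass AB).selmerGroup 5) : ℝ) ≤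
        (6 + η) * ((heightFamilyBelow X).filter T).card)
    (h13U₀ : ∀ η : ℝ, 0 < η → ∀ᶠ X : ℕ in atTop,
      ∑ AB ∈ (heightFamilyBelow X).filter U₀,
          (Nat.card ((shortWeierstrass AB).selmerGroup 5) : ℝ) ≤
        (6 + η) * ((heightFamilyBelow X).filter U₀).card)
    (hlocP : ∀ η : ℝ, 0 < η → ∀ᶠ X : ℕ in atTop,
      ∑ AB ∈ (heightFamilyBelow X).filter P, ((Nat.card (Z AB) : ℝ) - 1) ≤
        (1 + η) * ((heightFamilyBelow X).filter P).card)
    (hT : ∀ η : ℝ, 0 < η → ∀ᶠ X : ℕ in atTop,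
      (747265625 / 953369043 - 1 / 10000000 - η) * (heightFamilyBelow X).card ≤
        ((heightFamilyBelow X).filter T).card)
    (hκU : ∀ η : ℝ, 0 < η → ∀ᶠ X : ℕ in atTop,
      (0.5501 - η) * ((heightFamilyBelow X).filter T).card ≤ ((heightFamilyBelow X).filter U).card)
    (hR : ∀ η : ℝ, 0 < η → ∀ᶠ X : ℕ in atTop,
      (78125 / 3813476172 - 1 / 10000000 - η) * (heightFamilyBelow X).card ≤
        ((heightFamilyBelow X).filter R).card)
    (hκU₀ : ∀ η : ℝ, 0 < η → ∀ᶠ X : ℕ in atTop,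
      (0.5501 - η) * ((heightFamilyBelow X).filter R).card ≤ ((heightFamilyBelow X).filter U₀).card)
    (hPd : ∀ η : ℝ, 0 < η → ∀ᶠ X : ℕ in atTop,
      (20546875 / 1271158724 - 1 / 1000000 - η) * (heightFamilyBelow X).card ≤
        ((heightFamilyBelow X).filter P).card)
    (hν : ∀ η : ℝ, 0 < η → ∀ᶠ X : ℕ in atTop,
      (((heightFamilyBelow X).filter (fun AB ↦ T AB ∧ ¬ S₁ AB)).card : ℝ) ≤
        (0.00001 + η) * (heightFamilyBelow X).card)
    (hW : ∀ η : ℝ, 0 < η → ∀ᶠ X : ℕ in atTop,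
      (((heightFamilyBelow X).filter (fun AB ↦ ¬ W AB)).card : ℝ) ≤ η * (heightFamilyBelow X).card) :
    HeightDensityGE SatisfiesBSDRankLeOne (3059480216411717 / 4576171406400000) :=
  heightDensityGE_satisfiesBSDRankLeOne_of_resPieces hGZK hDD S₀ T U R U₀ P S₁ W Z hTS₀ hUT hRS₀ hRT
    hU₀R hPS₀ hPT hPR hU hUflip hU₀ hU₀flip h5 h9 hker hKim hWtors h13T h13U₀ hlocP (by norm_num)
    (by norm_num) (by norm_num) (by norm_num) (by norm_num) hT hκU hR hκU₀ hPd hν hW (by norm_num)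

end Literature.NumberTheory.EllipticCurves

end
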